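import Mathlib
import Summits.NavierStokesRegularity.NavierStokesRegularity.Theorems.WakeRatchetTailRatchetDSSAmplitudeFloor
import Summits.NavierStokesRegularity.NavierStokesRegularity.Theorems.WakeRatchetTailRatchet.Negative.TailRatchetFalseOfDyadicScalarFronts
import HarnessLib

/-!
# `WakeRatchet.TailRatchet` (stmt-NavierStokesRegularity-21808): the AMPLITUDE FLOOR of the scalar dyadic
# front — every profile of the construction item `DyadicScalarFronts` has `sup_{t<0} |t|·|a(t)| ≥ 1/(Λ − Λ⁻¹)`

Support file for the crux `TailRatchet` (route `WakeRatchet`; MODEL lattice ODEs of Tao 2016 §1.2, §4 —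
nothing in this file is a statement about the Navier–Stokes equations, and no item is closed here).

The crux is refuted modulo `WakeRatchetDyadicFront.DyadicScalarFronts` (p589335): a real function `a` on
`t < 0` with `a' = (Λ/s²)a(t/s)² − (s/Λ)a(t)a(st)`, integrable on `(−∞,0)`, bounded near `0⁻`,
non-trivial, at arbitrarily small `ε₀` (`Λ = bigLam ε₀`, some `s > 1`).  Through the dictionary
`isDSSWave_dyadic_of_scalarFront` (`Φ(x) = e^{−x}a(−e^{−x})e₀`, an admissible DSS wave of `dyadicTable`,
whose summed mass at phase `x` is exactly `|t|·|a(t)|`, `t = −e^{−x}`) the DSS amplitude floor of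
`WakeRatchetTailRatchetDSSAmplitudeFloor` gives a quantitative a-priori property of EVERY such profile:

* `fluxConst_dyadicTable` — the flux constant of the dyadic member is `1`;
* `scalarFront_one_le` — for a non-trivial profile, any bound `M₁ ≥ |t|·|a(t)|` (`t < 0`) has
  `(Λ − Λ⁻¹)·M₁ ≥ 1`;
* `scalarFront_exists_large` — for `0 < ε₀ ≤ 1` there is `t < 0` with `|t|·|a(t)| > 1/(14 ε₀)`.

READING FOR THE CENSUS of stmt-21808: in the critical variables `t·a(t)` (shell amplitude times time
to blow-up) the front the construction must produce reaches size `> 1/(14 ε₀)` — e.g. `> 23` at the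
kit-tested `ε₀ = 0.003` — consistent with the continuum picture `W ≈ V/log Λ`; any enclosure /
invariant box for the profile must scale like `ε₀⁻¹`.

HONEST FRAMING: elementary; MODEL lattice only; the construction item itself stays open.
-/

noncomputable section

set_option linter.dupNamespace false

namespace Summit.NavierStokesRegularity.NavierStokesRegularity.Theorems

namespace WakeRatchetScalarFrontFloor

open MeasureTheory Set Filter Topology
open Literature.Analysis.FluidPDE Literature.Analysis.FluidPDE.TaoCascade
open WakeRatchetDyadicFront WakeRatchetDSSAmplitudeFloor

/-- The flux constant of the dyadic member is `1` (its only `(0,0,1)` entry is `α_{000} = 1`).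
[cite: Tao2016AveragedNS, §1.2 (dyadic model), §4 (4.1); cell vocabulary (`dyadicTable`, `fluxConst`)] -/
theorem fluxConst_dyadicTable : fluxConst dyadicTable = 1 := by
  unfold fluxConst
  have hz : ∀ i i₁ i₂ : Fin 4, ¬ (i₁ = 0 ∧ i₂ = 0 ∧ i = 0) →
      |dyadicTable i₁ i₂ i ((0 : ℤ), (0 : ℤ), (1 : ℤ))| = 0 :=
    fun i i₁ i₂ hh => by rw [dyadicTable_of_not hh, abs_zero]
  rw [Fintype.sum_eq_single (0 : Fin 4) (fun i hi => Finset.sum_eq_zero fun i₁ _ =>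
        Finset.sum_eq_zero fun i₂ _ => hz i i₁ i₂ (fun hh => hi hh.2.2)),
      Fintype.sum_eq_single (0 : Fin 4) (fun i₁ hi₁ => Finset.sum_eq_zero fun i₂ _ =>
        hz 0 i₁ i₂ (fun hh => hi₁ hh.1)),
      Fintype.sum_eq_single (0 : Fin 4) (fun i₂ hi₂ => hz 0 0 i₂ (fun hh => hi₂ hh.2.1))]
  simp [dyadicTable]

variable {ε₀ s : ℝ} {a : ℝ → ℝ}

/-- The summed mass of the dictionary wave at phase `x` is `e^{−x}|a(−e^{−x})|`. [elementary] -/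
theorem sMass_dictionary (a : ℝ → ℝ) (x : ℝ) :
    sMass (fun (_ : Fin 1) (y : ℝ) => (Real.exp (-y) * a (-Real.exp (-y))) •
      EuclideanSpace.single (0 : Fin 4) (1 : ℝ)) x = Real.exp (-x) * |a (-Real.exp (-x))| := by
  unfold sMass
  simp [norm_smul, abs_of_pos (Real.exp_pos _)]

/-- **Amplitude floor of scalar dyadic fronts.**  For a non-trivial profile with the clauses of
`DyadicScalarFronts` at base `Λ = bigLam ε₀` (`ε₀ > 0`, `s > 1`), every bound `M₁` with
`|t|·|a(t)| ≤ M₁` for all `t < 0` satisfies `1 ≤ (Λ − Λ⁻¹)·M₁`.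
[cite: Tao2016AveragedNS, §1.2, §4 (4.1)–(4.3); cell theorem] -/
theorem scalarFront_one_le (hε : 0 < ε₀) (hs : 1 < s)
    (hode : ∀ t : ℝ, t < 0 → HasDerivAt a
      (bigLam ε₀ / s ^ 2 * a (t / s) ^ 2 - s / bigLam ε₀ * a t * a (s * t)) t)
    (hint : IntegrableOn a (Iio 0))
    (hbdd : ∃ t₀ : ℝ, t₀ < 0 ∧ ∃ P : ℝ, ∀ t : ℝ, t₀ ≤ t → t < 0 → |a t| ≤ P)
    (hne : ∃ t : ℝ, t < 0 ∧ a t ≠ 0) {M₁ : ℝ} (hM : ∀ t : ℝ, t < 0 → |t| * |a t| ≤ M₁) :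
    1 ≤ (bigLam ε₀ - (bigLam ε₀)⁻¹) * M₁ := by
  have hW := isDSSWave_dyadic_of_scalarFront hε hs hode hint hbdd
  have hc : IsCancellingCoeff dyadicTable := (inTableClass_dyadicTable le_rfl).2.1
  have hΛ1 : 1 ≤ bigLam ε₀ := one_le_bigLam hε.le
  have hnn : 0 ≤ bigLam ε₀ - (bigLam ε₀)⁻¹ := by
    have : (bigLam ε₀)⁻¹ ≤ 1 := inv_le_one_of_one_le₀ hΛ1
    linarith
  -- summed mass bound from `|t| |a t| ≤ M₁`
  have hmass : ∀ x, sMass (fun (_ : Fin 1) (y : ℝ) => (Real.exp (-y) * a (-Real.exp (-y))) •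
      EuclideanSpace.single (0 : Fin 4) (1 : ℝ)) x ≤ M₁ := by
    intro x
    rw [sMass_dictionary]
    have ht : -Real.exp (-x) < 0 := neg_neg_iff_pos.2 (Real.exp_pos _)
    have h := hM _ ht
    rwa [abs_neg, abs_of_pos (Real.exp_pos _)] at h
  -- non-triviality of the wave
  obtain ⟨t₁, ht₁, hat₁⟩ := hne
  have hne' : ∃ (r : Fin 1) (x : ℝ), (fun (_ : Fin 1) (y : ℝ) => (Real.exp (-y) * a (-Real.exp (-y))) •
      EuclideanSpace.single (0 : Fin 4) (1 : ℝ)) r x ≠ 0 := by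
    refine ⟨0, -Real.log (-t₁), ?_⟩
    have ht : -Real.exp (-(-Real.log (-t₁))) = t₁ := by
      rw [neg_neg, Real.exp_log (neg_pos.2 ht₁), neg_neg]
    simp only [ht]
    intro h0
    rw [smul_eq_zero] at h0
    rcases h0 with h0 | h0
    · exact (mul_ne_zero (Real.exp_pos _).ne' hat₁) h0
    · exact one_ne_zero ((PiLp.single_eq_zero_iff 2 (0 : Fin 4)).1 h0)
  have h := dssWave_one_le_of_ne_zero hc hW hmass hne'
  rwa [fluxConst_dyadicTable, mul_one, abs_of_nonneg hnn] at h

/-- **Scalar dyadic fronts are large at fine scale ratio**: for `0 < ε₀ ≤ 1` a non-trivial profile with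
the clauses of `DyadicScalarFronts` has a time `t < 0` with `|t|·|a(t)| > 1/(14 ε₀)`
(`Λ − Λ⁻¹ < 14 ε₀`). [cite: Tao2016AveragedNS, §1.2, §4 (4.1)–(4.3); cell theorem] -/
theorem scalarFront_exists_large (hε : 0 < ε₀) (hε1 : ε₀ ≤ 1) (hs : 1 < s)
    (hode : ∀ t : ℝ, t < 0 → HasDerivAt a
      (bigLam ε₀ / s ^ 2 * a (t / s) ^ 2 - s / bigLam ε₀ * a t * a (s * t)) t)
    (hint : IntegrableOn a (Iio 0))
    (hbdd : ∃ t₀ : ℝ, t₀ < 0 ∧ ∃ P : ℝ, ∀ t : ℝ, t₀ ≤ t → t < 0 → |a t| ≤ P)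
    (hne : ∃ t : ℝ, t < 0 ∧ a t ≠ 0) : ∃ t : ℝ, t < 0 ∧ 1 / (14 * ε₀) < |t| * |a t| := by
  by_contra h
  push Not at h
  have h1 := scalarFront_one_le hε hs hode hint hbdd hne (M₁ := 1 / (14 * ε₀)) h
  have h14 := bigLam_sub_inv_lt hε hε1
  have hq : 0 < 1 / (14 * ε₀) := by positivity
  have hlt : (bigLam ε₀ - (bigLam ε₀)⁻¹) * (1 / (14 * ε₀)) < 14 * ε₀ * (1 / (14 * ε₀)) :=
    mul_lt_mul_of_pos_right ((le_abs_self _).trans_lt h14) hq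
  have he : 14 * ε₀ * (1 / (14 * ε₀)) = 1 := by field_simp
  linarith

end WakeRatchetScalarFrontFloor

end Summit.NavierStokesRegularity.NavierStokesRegularity.Theorems

end
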